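import Summits.BirchSwinnertonDyer.BirchSwinnertonDyer.Theorems.AdditiveKolyvaginRoadRamifiedHabitatSignLawIZeroStar
import Summits.BirchSwinnertonDyer.BirchSwinnertonDyer.Theorems.AdditiveKolyvaginRoadRamifiedHabitatPStarTwistSignAnyLevel
import Literature.NumberTheory.EllipticCurves.QuadraticTwistKroneckerEvenRootNumberProofs
import HarnessLib

/-!
# Route `AdditiveKolyvaginRoad`, crux KS′ `LevelKolyvaginSystemsAdditive` (stmt-BirchSwinnertonDyer-21396), card `ramified-toric-habitat` —
# the RAMIFIED-HABITAT SIGN LAW for an EVEN habitat discriminant `d = p*·D'`, `4 ∣ D'`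

Cell `pub/bsd-wall`, width seat `bsd-wall-akr-p2x-w3` g13; `--supports stmt-BirchSwinnertonDyer-21396` (helper). THEOREMS ONLY; no definition,
no named fact, no `sorry`. BSD is not proved by any of this; KS′/KPA′ stay OPEN at `p² ∣ N`.

The w2 g11/g12 series (`…RamifiedHabitatSignLaw*`, `…PStarTwistSignAnyLevel`) proves the card's FIRST LEMMA — `w(E)·w(E^{(d)}) = +1 ⟺ e ∤ p − 1`
for the `p`-ramified habitat `d = p*·d'` — for ODD `d'` only: the last step `E^{(d)} = (E^{(p*)})^{(d')}` used the coprime twist law for an odd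
fundamental discriminant `d' ≡ 1 (4)`. Here the cofactor is an EVEN fundamental discriminant `D' = 4m` (`m ≡ 2, 3 (4)` squarefree): the
coprime twist law `w((E')^{(D')}) = sign(D')·(D'/N')·w(E')`, `N' = N_{E'}` (Murty–Murty Ch. 6 §1, the tree's `rootNumber_quadraticTwist_of_four_dvd`,
this seat's `Literature/…/QuadraticTwistKroneckerEvenRootNumberProofs`; NO hypothesis at `2` on the twist) gives the same reduction to the
`p*`-level, and everything downstream is the `p*`-level work of the series VERBATIM:

* §1 `jacobiSym_cofactor_eq_legendreSym_of_split_odd`, `jacobiSym_cofactor_natCast_eq_legendreSym_of_split` — `(D'/M) = (M/p)` when every prime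
  of the ODD number `M` splits in `ℚ(√d)` (ANY `M ≠ 0`, not only squarefree); `ite_neg_eq_neg_χ₄_of_pStar_mul_neg` — `sign D' = −(−1/p)` as `d < 0`.
* §2 `rootNumber_ramifiedTwist_of_four_dvd` — **`w(E^{(d)}) = −(−1/p)·(D'/N_{E'})·w(E')`**, `E' = E^{(p*)}`, for ANY `E` (structural; mod `hmod`);
  `rootNumber_mul_rootNumber_ramifiedTwist_of_four_dvd_of_pStar` — with `N_{E'} = M·p^k` and `w(E)w(E') = (M/p)·r`: `w(E)·w(E^{(d)}) = −(−1/p)·(D'/p)^k·r`.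
* §3 the sign laws for even `d`, types II/III/IV, ANY cofactor `M = N/p²` prime to `p` (via w2 g12's `…pStarTwist_anyLevel`):
  `rootNumber_mul_rootNumber_ramifiedTwist_even` and the dichotomy halves `…_eq_one_of_not_dvd` / `…_eq_neg_one_of_dvd` (`e ∤ p − 1 ⟹ +1`,
  `e ∣ p − 1 ⟹ −1`). The values coincide with the odd case: the place `2` enters only through `χ_{d,2}(−1)`, absorbed in the sign of `D'`
  (the tree's `RAMIFIED-HABITAT-SIGNLAW-NOTE.md`). Starred types and I₀* (squarefree `M`): companion `…SignLawEvenStarred`.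

Conditional, as the whole series, on the Modularity Theorem (`exists_isNewformOf`) and — except on type I₀* — Kellock–Dokchitser's Rem. 2.2 at `p`
for `E`, `E^{(p*)}` (named fact `atkinLehnerEigenvalueAt_eq_localRootNumberAt`). The habitat as a FIELD `K′` with `4 ∣ d_{K′}` and the card's Props
AS TYPED without parity binder follow in the companion files `…SignLawEvenStarred`, `…SignLawEvenField`, `…SignLawAsTypedAllDiscr`.

References: [cite: MurtyMurty1997, Ch. 6 §1] [cite: Rohrlich1993Compositio, Prop. 2(iv)] [cite: KellockDokchitser2023, Rem. 2.2]
[cite: MontgomeryVaughan2007, §9.3 Theorem 9.13].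
-/

set_option autoImplicit false
set_option linter.dupNamespace false

noncomputable section

open scoped Classical MatrixGroups NumberTheorySymbols

open CongruenceSubgroup IsDedekindDomain IsDedekindDomain.HeightOneSpectrum NumberField Rat.HeightOneSpectrum
  WeierstrassCurve Literature.NumberTheory.EllipticCurves Literature.NumberTheory.EllipticCurves.ModularForms
  IsDiscreteValuationRing

namespace Summit.BirchSwinnertonDyer.BirchSwinnertonDyer.Theorems.AdditiveKoly.RamifiedHabitat

/-! ## §1 Jacobi symbols of the even cofactor at the split primes, and its sign -/

section Jacobi

variable {p : ℕ} [Fact p.Prime]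

/-- At an odd prime `q` SPLIT in `ℚ(√d)`, `d = p*·D'` (`(d/q) = 1`): `(D'/q) = (q/p)`. Indeed `(p*/q)·(D'/q) = 1`, `(p*/q)² = 1` and
`(p*/q) = (q/p)` (`legendreSym_pStar`). No parity or sign condition on `D'`. [folklore] -/
theorem jacobiSym_cofactor_eq_legendreSym_of_split_odd (hp2 : p ≠ 2) {D' : ℤ} {q : ℕ} [Fact q.Prime] (hq2 : q ≠ 2)
    (hsplit : J((-1 : ℤ) ^ (p / 2) * p * D' | q) = 1) : J(D' | q) = legendreSym p q := by
  rw [jacobiSym.mul_left] at hsplit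
  set A := J((-1 : ℤ) ^ (p / 2) * p | q)
  haveI : NeZero q := ⟨(Fact.out : q.Prime).ne_zero⟩
  have hA0 : A ≠ 0 := fun h ↦ by rw [h, zero_mul] at hsplit; exact zero_ne_one hsplit
  have hA2 : A * A = 1 := by
    rw [← sq]
    exact jacobiSym.sq_one (by by_contra h; exact hA0 (jacobiSym.eq_zero_iff_not_coprime.mpr h))
  have hAp : A = legendreSym p q := by
    rw [← legendreSym_pStar hp2 hq2, jacobiSym.legendreSym.to_jacobiSym]
  calc J(D' | q) = A * (A * J(D' | q)) := by rw [← mul_assoc, hA2, one_mul]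
    _ = legendreSym p q := by rw [hsplit, mul_one, hAp]

/-- `(D'/M) = (M/p)` for an ODD `M ≠ 0` all of whose primes split in `ℚ(√d)`, `d = p*·D'` (prime by prime, both sides multiplicative in
`M`; no squarefree hypothesis on `M`, so that a second additive prime `q ≠ p` of `E` is allowed). [folklore] -/
theorem jacobiSym_cofactor_natCast_eq_legendreSym_of_split (hp2 : p ≠ 2) {D' : ℤ} {M : ℕ} (hM0 : M ≠ 0) (hM2 : ¬ 2 ∣ M)
    (hsplit : ∀ q ∈ M.primeFactors, q ≠ 2 → J((-1 : ℤ) ^ (p / 2) * p * D' | q) = 1) :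
    J(D' | M) = legendreSym p M := by
  induction M using Nat.recOnMul with
  | zero => exact absurd rfl hM0
  | one => rw [jacobiSym.one_right, Nat.cast_one, legendreSym.at_one]
  | prime q hq =>
    haveI := Fact.mk hq
    have hq2 : q ≠ 2 := fun h ↦ hM2 (h ▸ dvd_rfl)
    exact jacobiSym_cofactor_eq_legendreSym_of_split_odd hp2 hq2
      (hsplit q (Nat.mem_primeFactors.mpr ⟨hq, dvd_rfl, hq.ne_zero⟩) hq2)
  | mul a b iha ihb =>
    have ha0 : a ≠ 0 := fun h ↦ hM0 (by rw [h, zero_mul])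
    have hb0 : b ≠ 0 := fun h ↦ hM0 (by rw [h, mul_zero])
    have ha2 : ¬ 2 ∣ a := fun h ↦ hM2 (h.mul_right b)
    have hb2 : ¬ 2 ∣ b := fun h ↦ hM2 (h.mul_left a)
    have hsa : ∀ q ∈ a.primeFactors, q ≠ 2 → J((-1 : ℤ) ^ (p / 2) * p * D' | q) = 1 := fun q hq hq2 ↦ by
      obtain ⟨hqp, hqa, -⟩ := Nat.mem_primeFactors.mp hq
      exact hsplit q (Nat.mem_primeFactors.mpr ⟨hqp, hqa.mul_right b, mul_ne_zero ha0 hb0⟩) hq2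
    have hsb : ∀ q ∈ b.primeFactors, q ≠ 2 → J((-1 : ℤ) ^ (p / 2) * p * D' | q) = 1 := fun q hq hq2 ↦ by
      obtain ⟨hqp, hqb, -⟩ := Nat.mem_primeFactors.mp hq
      exact hsplit q (Nat.mem_primeFactors.mpr ⟨hqp, hqb.mul_left a, mul_ne_zero ha0 hb0⟩) hq2
    rw [jacobiSym.mul_right' D' ha0 hb0, Nat.cast_mul, legendreSym.mul, iha ha0 ha2 hsa, ihb hb0 hb2 hsb]

/-- `sign D' = −(−1/p)` when `d = p*·D' < 0`: `sign D' = −sign p* = −χ₄(p)`. [folklore] -/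
theorem ite_neg_eq_neg_χ₄_of_pStar_mul_neg (hp2 : p ≠ 2) {D' : ℤ} (hneg : (-1 : ℤ) ^ (p / 2) * p * D' < 0) :
    (if D' < 0 then -1 else 1 : ℤ) = -ZMod.χ₄ p := by
  have hp' := (Nat.Prime.eq_two_or_odd (Fact.out : p.Prime)).resolve_left hp2
  have hp0 : (0 : ℤ) < p := by exact_mod_cast (Fact.out : p.Prime).pos
  rcases Nat.odd_mod_four_iff.mp hp' with hp4 | hp4
  · rw [ZMod.neg_one_pow_div_two_of_one_mod_four hp4, one_mul] at hneg
    have hD : D' < 0 := by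
      by_contra h
      push Not at h
      exact absurd hneg (not_lt.mpr (mul_nonneg hp0.le h))
    rw [if_pos hD, ZMod.χ₄_nat_one_mod_four hp4]
  · rw [ZMod.neg_one_pow_div_two_of_three_mod_four hp4] at hneg
    have hD : ¬ D' < 0 := by
      intro h
      exact absurd hneg (not_lt.mpr (by nlinarith))
    rw [if_neg hD, ZMod.χ₄_nat_three_mod_four hp4]
    norm_num

end Jacobi

/-! ## §2 From the `p*`-twist to the habitat twist, even cofactor -/

section Structural

variable {p : ℕ} [Fact p.Prime]

/-- **`w(E^{(d)}) = −(−1/p)·(D'/N_{E'})·w(E')` and `N_{E^{(d)}} = N_{E'}·D'²`** for `d = p*·D' < 0` with `D' = 4m` an EVEN fundamental discriminant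
(`m ≡ 2, 3 (4)` squarefree) prime to `N_{E'}`, `E' = E^{(p*)}` — for ANY elliptic `E/ℚ` and odd `p` (the reduction type at `p` enters only later,
through `N_{E'}` and `w(E)·w(E')`). Mechanism: `E^{(d)} = (E')^{(D')}` (`quadraticTwist_quadraticTwist`) and the even coprime twist law
`w((E')^{(D')}) = sign(D')·(D'/N_{E'})·w(E')` (Murty–Murty Ch. 6 §1 through the Kronecker character mod `|D'|`; `rootNumber_quadraticTwist_of_four_dvd`),
with `sign D' = −(−1/p)`. Conditional on the Modularity Theorem (`hmod`). [cite: MurtyMurty1997, Ch. 6 §1] [cite: MontgomeryVaughan2007, §9.3 Theorem 9.13] -/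
theorem rootNumber_ramifiedTwist_of_four_dvd (W : WeierstrassCurve ℚ) [W.IsElliptic] (hmod : exists_isNewformOf) (hp2 : p ≠ 2)
    {D' : ℤ} (h4 : 4 ∣ D') (hm4 : D' / 4 % 4 = 2 ∨ D' / 4 % 4 = 3) (hsq : Squarefree (D' / 4))
    (hgcd : Int.gcd D' ((W.quadraticTwist (((-1 : ℤ) ^ (p / 2) * p : ℤ) : ℚ)).conductorNorm ℤ) = 1)
    (hneg : (-1 : ℤ) ^ (p / 2) * p * D' < 0) :
    (W.quadraticTwist (((-1 : ℤ) ^ (p / 2) * p * D' : ℤ) : ℚ)).rootNumber =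
        -ZMod.χ₄ p * J(D' | (W.quadraticTwist (((-1 : ℤ) ^ (p / 2) * p : ℤ) : ℚ)).conductorNorm ℤ) *
          (W.quadraticTwist (((-1 : ℤ) ^ (p / 2) * p : ℤ) : ℚ)).rootNumber ∧
      (W.quadraticTwist (((-1 : ℤ) ^ (p / 2) * p * D' : ℤ) : ℚ)).conductorNorm ℤ =
        (W.quadraticTwist (((-1 : ℤ) ^ (p / 2) * p : ℤ) : ℚ)).conductorNorm ℤ * D'.natAbs ^ 2 := by
  have hp : p.Prime := Fact.out
  have hdZ0 : ((-1 : ℤ) ^ (p / 2) * p : ℤ) ≠ 0 :=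
    mul_ne_zero (pow_ne_zero _ (by norm_num)) (by exact_mod_cast hp.ne_zero)
  have hd0 : (((((-1 : ℤ) ^ (p / 2) * p : ℤ)) : ℚ)) ≠ 0 := by exact_mod_cast hdZ0
  haveI hE' : (W.quadraticTwist (((-1 : ℤ) ^ (p / 2) * p : ℤ) : ℚ)).IsElliptic := W.isElliptic_quadraticTwist hd0
  have hB := (W.quadraticTwist (((-1 : ℤ) ^ (p / 2) * p : ℤ) : ℚ)).rootNumber_quadraticTwist_of_four_dvd hmod h4 hm4 hsq hgcd
  rw [quadraticTwist_quadraticTwist] at hB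
  have hcast : ((((-1 : ℤ) ^ (p / 2) * p : ℤ) : ℚ)) * (D' : ℚ) = (((-1 : ℤ) ^ (p / 2) * p * D' : ℤ) : ℚ) := by push_cast; ring
  rw [hcast, ite_neg_eq_neg_χ₄_of_pStar_mul_neg hp2 hneg] at hB
  exact hB

/-- **`w(E)·w(E^{(d)}) = −(−1/p)·(D'/p)^k·r` from the `p*`-level**, `d = p*·D'` with EVEN cofactor `D' = 4m`: if `N_{E'} = M·p^k` (`p ∤ M`; `k = 2` when
`E'` is additive at `p`, `k = 1` multiplicative, `k = 0` good), `(D', M p^k) = 1`, `d < 0`, every prime of `M` SPLIT in `ℚ(√d)` (they are odd: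
`2 ∣ D'`), and `w(E)·w(E') = (M/p)·r`, then `w(E)·w(E^{(d)}) = −(−1/p)·(D'/p)^k·r` — §2's law, `(D'/M p^k) = (D'/M)(D'/p)^k`, `(D'/M) = (M/p)` (§1)
and `(M/p)² = 1`. Conditional on `hmod`. [cite: MurtyMurty1997, Ch. 6 §1] -/
theorem rootNumber_mul_rootNumber_ramifiedTwist_of_four_dvd_of_pStar (W : WeierstrassCurve ℚ) [W.IsElliptic]
    (hmod : exists_isNewformOf) (hp2 : p ≠ 2) {M k : ℕ} (hpM : ¬ p ∣ M)
    (hN' : (W.quadraticTwist (((-1 : ℤ) ^ (p / 2) * p : ℤ) : ℚ)).conductorNorm ℤ = M * p ^ k) {r : ℤ}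
    (hA : W.rootNumber * (W.quadraticTwist (((-1 : ℤ) ^ (p / 2) * p : ℤ) : ℚ)).rootNumber = legendreSym p M * r)
    {D' : ℤ} (h4 : 4 ∣ D') (hm4 : D' / 4 % 4 = 2 ∨ D' / 4 % 4 = 3) (hsq : Squarefree (D' / 4))
    (hgcd : Int.gcd D' (M * p ^ k : ℕ) = 1) (hneg : (-1 : ℤ) ^ (p / 2) * p * D' < 0)
    (hsplit : ∀ q ∈ M.primeFactors, q ≠ 2 → J((-1 : ℤ) ^ (p / 2) * p * D' | q) = 1) :
    W.rootNumber * (W.quadraticTwist (((-1 : ℤ) ^ (p / 2) * p * D' : ℤ) : ℚ)).rootNumber =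
      -ZMod.χ₄ p * J(D' | p) ^ k * r := by
  have hp : p.Prime := Fact.out
  have hdZ0 : ((-1 : ℤ) ^ (p / 2) * p : ℤ) ≠ 0 :=
    mul_ne_zero (pow_ne_zero _ (by norm_num)) (by exact_mod_cast hp.ne_zero)
  have hd0 : (((((-1 : ℤ) ^ (p / 2) * p : ℤ)) : ℚ)) ≠ 0 := by exact_mod_cast hdZ0
  haveI hE' : (W.quadraticTwist (((-1 : ℤ) ^ (p / 2) * p : ℤ) : ℚ)).IsElliptic := W.isElliptic_quadraticTwist hd0
  have hgcdN : Int.gcd D' ((W.quadraticTwist (((-1 : ℤ) ^ (p / 2) * p : ℤ) : ℚ)).conductorNorm ℤ) = 1 := by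
    rw [hN']; exact hgcd
  obtain ⟨hB, -⟩ := rootNumber_ramifiedTwist_of_four_dvd W hmod hp2 h4 hm4 hsq hgcdN hneg
  rw [hN'] at hB
  -- `M ≠ 0` and `M` is odd
  have hM0 : M ≠ 0 := by
    intro h
    have h0 := (W.quadraticTwist (((-1 : ℤ) ^ (p / 2) * p : ℤ) : ℚ)).conductorNorm_pos_holds
    rw [hN', h, zero_mul] at h0
    exact lt_irrefl _ h0
  have hcop : Nat.Coprime D'.natAbs (M * p ^ k) := by
    have h := hgcd
    simp only [Int.gcd, Int.natAbs_natCast] at h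
    exact h
  have hM2 : ¬ 2 ∣ M := by
    intro h2M
    have h2D : 2 ∣ D'.natAbs := by
      have h := Int.natAbs_dvd_natAbs.mpr (dvd_trans (⟨2, by norm_num⟩ : (2 : ℤ) ∣ 4) h4)
      simpa using h
    have h1 : (2 : ℕ) ∣ 1 := by
      rw [← hcop.gcd_eq_one]
      exact Nat.dvd_gcd h2D (h2M.mul_right _)
    omega
  -- `(D' / M p^k) = (M/p)·(D'/p)^k`
  have hJ : J(D' | M * p ^ k) = legendreSym p M * J(D' | p) ^ k := by
    rw [jacobiSym.mul_right' D' hM0 (pow_ne_zero k hp.ne_zero),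
      jacobiSym_cofactor_natCast_eq_legendreSym_of_split hp2 hM0 hM2 hsplit, jacobiSym.pow_right]
  have hM2' : legendreSym p M * legendreSym p M = 1 := by
    rw [← sq]
    refine legendreSym.sq_one p ?_
    rw [Int.cast_natCast, ne_eq, ZMod.natCast_eq_zero_iff]
    exact hpM
  calc W.rootNumber * (W.quadraticTwist (((-1 : ℤ) ^ (p / 2) * p * D' : ℤ) : ℚ)).rootNumber
      = -ZMod.χ₄ p * J(D' | M * p ^ k) *
          (W.rootNumber * (W.quadraticTwist (((-1 : ℤ) ^ (p / 2) * p : ℤ) : ℚ)).rootNumber) := by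
        rw [hB]; push_cast; ring
    _ = -ZMod.χ₄ p * (legendreSym p M * J(D' | p) ^ k) * (legendreSym p M * r) := by rw [hJ, hA]
    _ = -ZMod.χ₄ p * J(D' | p) ^ k * r := by linear_combination (-(ZMod.χ₄ p) * J(D' | p) ^ k * r) * hM2'

end Structural

/-! ## §3 The sign laws for an even habitat discriminant -/

section SignLawEven

variable {p : ℕ} [Fact p.Prime]

/-- `χ₄(p)² = 1` for odd `p`. [folklore] -/
theorem χ₄_natCast_mul_self (hp2 : p ≠ 2) : ZMod.χ₄ p * ZMod.χ₄ p = 1 := by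
  have hp' := (Nat.Prime.eq_two_or_odd (Fact.out : p.Prime)).resolve_left hp2
  rw [ZMod.χ₄_nat_eq_if_mod_four]
  have : p % 4 = 1 ∨ p % 4 = 3 := by omega
  have h2' : p % 2 ≠ 0 := by omega
  rcases this with h | h <;> simp [h, h2']

omit [Fact p.Prime] in
/-- `(D'/p)² = 1` when `(D', M p²) = 1`. [folklore] -/
theorem jacobiSym_cofactor_prime_sq_eq_one {D' : ℤ} {M : ℕ} (hgcd : Int.gcd D' (M * p ^ 2 : ℕ) = 1) :
    J(D' | p) ^ 2 = 1 := by
  refine jacobiSym.sq_one ?_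
  have hcop : Nat.Coprime D'.natAbs (M * p ^ 2) := by
    have h := hgcd
    simp only [Int.gcd, Int.natAbs_natCast] at h
    exact h
  have h : Nat.Coprime D'.natAbs p :=
    (Nat.Coprime.coprime_dvd_right (Dvd.intro_left M rfl : p ^ 2 ∣ M * p ^ 2) hcop).coprime_dvd_right
      (dvd_pow_self p two_ne_zero)
  simp only [Int.gcd, Int.natAbs_natCast]
  exact h

/-- **THE RAMIFIED-HABITAT SIGN RATIO, EVEN HABITAT DISCRIMINANT, TYPES II/III/IV, ANY COFACTOR.** `W/ℚ` elliptic of conductor `N = M·p²`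
(`p ≥ 5`, `p ∤ M`, `M` ARBITRARY — other additive primes allowed), minimal model at `p` with `ord_p Δ = a ∈ {2,3,4}`, `ord_p c₄ > 0`,
`3 ord_p c₄ ≥ ord_p Δ` (types II/III/IV, `e = 6, 4, 3`); `d = p*·D'` with `D' = 4m` an EVEN fundamental discriminant (`m ≡ 2, 3 (4)` squarefree)
prime to `N`, `d < 0`, every prime `q ∣ M` SPLIT in `ℚ(√d)`. ASSUMING the Modularity Theorem and Kellock–Dokchitser's Rem. 2.2 for `W`, `W^{(p*)}`:
`w(W)·w(W^{(d)}) = −(−1/p)` if `e = 4` and `= −(−3/p)` if `e ∈ {3, 6}` — the same values as for odd `d'` (`rootNumber_mul_rootNumber_ramifiedTwist`).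
[cite: MurtyMurty1997, Ch. 6 §1] [cite: Rohrlich1993Compositio, Prop. 2(iv)] [cite: KellockDokchitser2023, Rem. 2.2] -/
theorem rootNumber_mul_rootNumber_ramifiedTwist_even (W : WeierstrassCurve ℚ) [W.IsElliptic] (hmod : exists_isNewformOf)
    (hF1 : W.atkinLehnerEigenvalueAt_eq_localRootNumberAt)
    (hF1' : (W.quadraticTwist (((-1 : ℤ) ^ (p / 2) * p : ℤ) : ℚ)).atkinLehnerEigenvalueAt_eq_localRootNumberAt)
    (hp5 : 5 ≤ p) {M : ℕ} (hN : W.conductorNorm ℤ = M * p ^ 2) (hpM : ¬ p ∣ M) {a : ℕ}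
    (hΔ : addVal ℤ_[p] (((W.baseChange ℚ_[p]).minimal ℤ_[p]).integralModel ℤ_[p]).Δ = a)
    (ha : a = 2 ∨ a = 3 ∨ a = 4)
    (hc₄ : addVal ℤ_[p] (((W.baseChange ℚ_[p]).minimal ℤ_[p]).integralModel ℤ_[p]).c₄ ≠ 0)
    (hj : ¬ 3 * addVal ℤ_[p] (((W.baseChange ℚ_[p]).minimal ℤ_[p]).integralModel ℤ_[p]).c₄ <
      addVal ℤ_[p] (((W.baseChange ℚ_[p]).minimal ℤ_[p]).integralModel ℤ_[p]).Δ)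
    {D' : ℤ} (h4 : 4 ∣ D') (hm4 : D' / 4 % 4 = 2 ∨ D' / 4 % 4 = 3) (hsq : Squarefree (D' / 4))
    (hgcd : Int.gcd D' (W.conductorNorm ℤ) = 1) (hneg : (-1 : ℤ) ^ (p / 2) * p * D' < 0)
    (hsplit : ∀ q ∈ M.primeFactors, q ≠ 2 → J((-1 : ℤ) ^ (p / 2) * p * D' | q) = 1) :
    W.rootNumber * (W.quadraticTwist (((-1 : ℤ) ^ (p / 2) * p * D' : ℤ) : ℚ)).rootNumber =
      if a = 3 then -ZMod.χ₄ p else -(if p % 3 = 1 then 1 else -1) := by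
  have hp : p.Prime := Fact.out
  have hp2 : p ≠ 2 := by omega
  have hdZ0 : ((-1 : ℤ) ^ (p / 2) * p : ℤ) ≠ 0 :=
    mul_ne_zero (pow_ne_zero _ (by norm_num)) (by exact_mod_cast hp.ne_zero)
  have hd0 : (((((-1 : ℤ) ^ (p / 2) * p : ℤ)) : ℚ)) ≠ 0 := by exact_mod_cast hdZ0
  haveI hE' : (W.quadraticTwist (((-1 : ℤ) ^ (p / 2) * p : ℤ) : ℚ)).IsElliptic := W.isElliptic_quadraticTwist hd0
  have hA := rootNumber_mul_rootNumber_pStarTwist_anyLevel W hmod hF1 hF1' hp5 hN hpM hΔ ha hc₄ hj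
  obtain ⟨hadd, hadd', -⟩ := localRootNumber_mul_pStarTwist_padic W hp5 hΔ ha hc₄ hj
  have hN' : (W.quadraticTwist (((-1 : ℤ) ^ (p / 2) * p : ℤ) : ℚ)).conductorNorm ℤ = M * p ^ 2 :=
    (conductorNorm_pStarTwist_eq W hp5 hadd hadd').trans hN
  have hgcd' : Int.gcd D' (M * p ^ 2 : ℕ) = 1 := by rw [← hN]; exact hgcd
  rw [rootNumber_mul_rootNumber_ramifiedTwist_of_four_dvd_of_pStar W hmod hp2 hpM hN' hA h4 hm4 hsq hgcd' hneg hsplit,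
    jacobiSym_cofactor_prime_sq_eq_one hgcd']
  have hχ₄ := χ₄_natCast_mul_self hp2
  split_ifs
  · ring
  · linear_combination -hχ₄
  · linear_combination hχ₄

/-- **SUPERCUSPIDAL HALF, even habitat discriminant (`e ∤ p − 1 ⟹ +1`)**, types II/III/IV, any cofactor `M`; `e := 12/gcd(12, a)`.
Conditional on {hmod, F1 at `p`}. [cite: Rohrlich1993Compositio, Prop. 2(iv)] [cite: KellockDokchitser2023, Rem. 2.2] -/
theorem rootNumber_mul_rootNumber_ramifiedTwist_even_eq_one_of_not_dvd (W : WeierstrassCurve ℚ) [W.IsElliptic]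
    (hmod : exists_isNewformOf) (hF1 : W.atkinLehnerEigenvalueAt_eq_localRootNumberAt)
    (hF1' : (W.quadraticTwist (((-1 : ℤ) ^ (p / 2) * p : ℤ) : ℚ)).atkinLehnerEigenvalueAt_eq_localRootNumberAt)
    (hp5 : 5 ≤ p) {M : ℕ} (hN : W.conductorNorm ℤ = M * p ^ 2) (hpM : ¬ p ∣ M) {a : ℕ}
    (hΔ : addVal ℤ_[p] (((W.baseChange ℚ_[p]).minimal ℤ_[p]).integralModel ℤ_[p]).Δ = a)
    (ha : a = 2 ∨ a = 3 ∨ a = 4)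
    (hc₄ : addVal ℤ_[p] (((W.baseChange ℚ_[p]).minimal ℤ_[p]).integralModel ℤ_[p]).c₄ ≠ 0)
    (hj : ¬ 3 * addVal ℤ_[p] (((W.baseChange ℚ_[p]).minimal ℤ_[p]).integralModel ℤ_[p]).c₄ <
      addVal ℤ_[p] (((W.baseChange ℚ_[p]).minimal ℤ_[p]).integralModel ℤ_[p]).Δ)
    {D' : ℤ} (h4 : 4 ∣ D') (hm4 : D' / 4 % 4 = 2 ∨ D' / 4 % 4 = 3) (hsq : Squarefree (D' / 4))
    (hgcd : Int.gcd D' (W.conductorNorm ℤ) = 1) (hneg : (-1 : ℤ) ^ (p / 2) * p * D' < 0)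
    (hsplit : ∀ q ∈ M.primeFactors, q ≠ 2 → J((-1 : ℤ) ^ (p / 2) * p * D' | q) = 1)
    (hsc : ¬ 12 / Nat.gcd a 12 ∣ p - 1) :
    W.rootNumber * (W.quadraticTwist (((-1 : ℤ) ^ (p / 2) * p * D' : ℤ) : ℚ)).rootNumber = 1 := by
  rw [rootNumber_mul_rootNumber_ramifiedTwist_even W hmod hF1 hF1' hp5 hN hpM hΔ ha hc₄ hj h4 hm4 hsq hgcd hneg hsplit]
  have hp' := (Nat.Prime.eq_two_or_odd (Fact.out : p.Prime)).resolve_left (by omega)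
  rcases ha with rfl | rfl | rfl
  · have e6 : 12 / Nat.gcd 2 12 = 6 := by decide
    rw [e6] at hsc
    have h3 : p % 3 ≠ 1 := fun h ↦ hsc (by omega)
    simp [h3]
  · have e4 : 12 / Nat.gcd 3 12 = 4 := by decide
    rw [e4] at hsc
    have h4' : p % 4 = 3 := by omega
    simp [ZMod.χ₄_nat_three_mod_four h4']
  · have e3 : 12 / Nat.gcd 4 12 = 3 := by decide
    rw [e3] at hsc
    have h3 : p % 3 ≠ 1 := fun h ↦ hsc (by omega)
    simp [h3]

/-- **PRINCIPAL-SERIES HALF, even habitat discriminant (`e ∣ p − 1 ⟹ −1`)**, types II/III/IV, any cofactor `M`; potentially good.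
Conditional on {hmod, F1 at `p`}. [cite: Rohrlich1993Compositio, Prop. 2(iv)] [cite: KellockDokchitser2023, Rem. 2.2] -/
theorem rootNumber_mul_rootNumber_ramifiedTwist_even_eq_neg_one_of_dvd (W : WeierstrassCurve ℚ) [W.IsElliptic]
    (hmod : exists_isNewformOf) (hF1 : W.atkinLehnerEigenvalueAt_eq_localRootNumberAt)
    (hF1' : (W.quadraticTwist (((-1 : ℤ) ^ (p / 2) * p : ℤ) : ℚ)).atkinLehnerEigenvalueAt_eq_localRootNumberAt)
    (hp5 : 5 ≤ p) {M : ℕ} (hN : W.conductorNorm ℤ = M * p ^ 2) (hpM : ¬ p ∣ M) {a : ℕ}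
    (hΔ : addVal ℤ_[p] (((W.baseChange ℚ_[p]).minimal ℤ_[p]).integralModel ℤ_[p]).Δ = a)
    (ha : a = 2 ∨ a = 3 ∨ a = 4)
    (hc₄ : addVal ℤ_[p] (((W.baseChange ℚ_[p]).minimal ℤ_[p]).integralModel ℤ_[p]).c₄ ≠ 0)
    (hj : ¬ 3 * addVal ℤ_[p] (((W.baseChange ℚ_[p]).minimal ℤ_[p]).integralModel ℤ_[p]).c₄ <
      addVal ℤ_[p] (((W.baseChange ℚ_[p]).minimal ℤ_[p]).integralModel ℤ_[p]).Δ)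
    {D' : ℤ} (h4 : 4 ∣ D') (hm4 : D' / 4 % 4 = 2 ∨ D' / 4 % 4 = 3) (hsq : Squarefree (D' / 4))
    (hgcd : Int.gcd D' (W.conductorNorm ℤ) = 1) (hneg : (-1 : ℤ) ^ (p / 2) * p * D' < 0)
    (hsplit : ∀ q ∈ M.primeFactors, q ≠ 2 → J((-1 : ℤ) ^ (p / 2) * p * D' | q) = 1)
    (hps : 12 / Nat.gcd a 12 ∣ p - 1) :
    W.rootNumber * (W.quadraticTwist (((-1 : ℤ) ^ (p / 2) * p * D' : ℤ) : ℚ)).rootNumber = -1 := by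
  rw [rootNumber_mul_rootNumber_ramifiedTwist_even W hmod hF1 hF1' hp5 hN hpM hΔ ha hc₄ hj h4 hm4 hsq hgcd hneg hsplit]
  have hp' := (Nat.Prime.eq_two_or_odd (Fact.out : p.Prime)).resolve_left (by omega)
  rcases ha with rfl | rfl | rfl
  · have e6 : 12 / Nat.gcd 2 12 = 6 := by decide
    rw [e6] at hps
    have h3 : p % 3 = 1 := by omega
    simp [h3]
  · have e4 : 12 / Nat.gcd 3 12 = 4 := by decide
    rw [e4] at hps
    have h4' : p % 4 = 1 := by omega
    simp [ZMod.χ₄_nat_one_mod_four h4']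
  · have e3 : 12 / Nat.gcd 4 12 = 3 := by decide
    rw [e3] at hps
    have h3 : p % 3 = 1 := by omega
    simp [h3]

end SignLawEven

end Summit.BirchSwinnertonDyer.BirchSwinnertonDyer.Theorems.AdditiveKoly.RamifiedHabitat

end
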